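import Summits.ABC.ABC.Theorems.IsogenyGlueCongruenceMazurKenkuBoundOfLiteInputs
import Summits.ABC.ABC.Theorems.IsogenyGlueCongruenceMazurKenkuBoundStubFifteenPoints
import Summits.ABC.ABC.Theorems.IsogenyGlueCongruenceMazurKenkuBoundStubTwentyonePoints
import Literature.NumberTheory.EllipticCurves.XZeroFifteenExplicit
import Literature.NumberTheory.EllipticCurves.XZeroTwentyOneExplicit
import Literature.NumberTheory.EllipticCurves.Curve15A1Descent
import Literature.NumberTheory.EllipticCurves.Curve21A1Descent
import HarnessLib

/-!
# `MazurKenkuBound` (stmt-ABC-15125) and the Mazur–Kenku radius from EIGHT `j`-tables: the composite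
# genus-one levels `15 = 3·5` and `21 = 3·7` of Kenku's table, PROVED

Route `IsogenyGlueCongruence`, crux `MazurKenkuBound`, line `radius-lite` (lead c22, cycle 24,
2026-08-17). Sorry-free, axiom-clean companion of the registered skeleton
`Cruxes/MazurKenkuBound/Lines/radius_lite.lean` (reshape #2), sharpening the cycle-23 closer
`…OfLiteInputs.lean` (p145823: inputs `h44`, TEN `j`-tables, six smooth levels): the two COMPOSITE
genus-one levels of the ten-table schema are now theorems, modular-curve-free —

* **level `15`** (`levelFifteen_jTable`, UNCONDITIONAL): a cyclic `ℚ`-isogeny of degree `15` out of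
  `V` has `j(V) ∈ {−5²/2, −5²·241³/2³, −5·29³/2⁵, 5·211³/2¹⁵}`. Klein–Fricke at `3` and `5`
  (`exists_j_eq_klein_three/five_of_…_dvd_degree`) give a non-cuspidal rational point of
  `X₀(3) ×_{X(1)} X₀(5)`, the tree's explicit isomorphism `XZeroFifteen.exists_point` (Thorne 2019,
  Lemma 3) a rational point of `15a1 : y² + xy + y = x³ + x² − 10x − 10` carrying `j(V)` as the value
  of `(N² + 10NB + 5B²)³/(N B⁵)`, and the eight rational points of `15a1`
  (`Curve15A1.finite_point`, p164644, complete `2`-descent; `stub_fifteenPoints`, p164365,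
  reduction mod `7, 11`) are four cusps (`N B⁵ = 0`) and four points with the tabulated values;
* **level `21`** (`levelTwentyOne_jTable_of`, conditional ONLY on Klein–Fricke at `7` over `ℚ`,
  `hK7`, which is PROVED in the tree — `exists_j_eq_klein_seven_of_degree_eq_seven` with the lead's
  `Isogeny.j_ne_zero_of_degree_eq_seven_rat`, p164792 — but `computational`, so kept as a displayed
  hypothesis here; the unconditional `computational` corollary is `…LevelTwentyOne.lean`): a cyclic
  `21`-isogeny gives `j(V) ∈ {−3²5⁶/2³, 3³5³/2, −3²5³101³/2²¹, −3³5³383³/2⁷}`, through the lead's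
  explicit isomorphism `X₀(3) ×_{X(1)} X₀(7) ≅ 21a1` (`XZeroTwentyOne.exists_point_rat`, p164263:
  `t · B(x,y) = N(x,y)` on `21a1 : y² + xy = x³ − 4x − 1`) and the eight rational points of `21a1`
  (`Curve21A1.finite_point`, p164609; `stub_twentyonePoints`, p163916).

Hence (`jTables_of_eight`) the ten-table schema follows from the EIGHT printed tables
`N ∈ {11, 17, 19, 27, 37, 43, 67, 163}` and `hK7`, and the crux and the sibling crux
`RibetTakahashiSplit.MazurKenkuRadius` hold conditionally on exactly: Mazur's Cor. 4.4 (`h44`), the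
eight tables (`hT8`), the six smooth levels `26, 35, 49, 65, 125, 169` (`hL6`), and `hK7`
(`mazurKenkuRadius_of_eight`, `mazurKenkuBound_of_eight`).

## References
[Kenku1982] M. A. Kenku, J. Number Theory 15 (1982) 199–202 · [Mazur1978] B. Mazur, Invent. Math.
44 (1978), Cor. 4.4 · [Ligozat1975] G. Ligozat, Mém. SMF 43 · [Thorne2019] J. A. Thorne, JEMS,
Lemma 3 · [CremonaAlgorithms1997] Table 1, `15A1`, `21A1` · [SilvermanAEC2009] III.4.12, X.1.4.
-/

-- `Summit.ABC.ABC` is the mandated summit-side namespace (CONVENTIONS §2); the duplicate is deliberate.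
set_option linter.dupNamespace false

noncomputable section
open scoped Classical
open WeierstrassCurve
open Literature.NumberTheory.EllipticCurves

namespace Summit.ABC.ABC.Theorems

/-! ### Level `15` (unconditional) -/

/-- `20` is not a rational square. [folklore] -/
theorem rat_sq_ne_twenty (q : ℚ) : q ^ 2 ≠ 20 := fun h ↦
  rat_sq_ne_five (q / 2) (by rw [div_pow, h]; norm_num)

/-- On `X₀(5)`, a RATIONAL Klein–Fricke parameter never lies over `j = 0` or `j = 1728`:
`j H = (H² + 10H + 5)³`, `H ∈ ℚ` forces `j ≠ 0` (`(H + 5)² = 20`) and `j ≠ 1728`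
(`(H² + 10H + 5)³ − 1728 H = (H² + 4H − 1)²(H² + 22H + 125)`, `(H + 2)² = 5`,
`(H + 11)² + 4 = 0`). [folklore] -/
theorem klein_five_j_ne_zero_and_ne_1728 {j H : ℚ}
    (hjH : j * H = (H ^ 2 + 10 * H + 5) ^ 3) : j ≠ 0 ∧ j ≠ 1728 := by
  constructor
  · rintro rfl
    have h3 : (H ^ 2 + 10 * H + 5) ^ 3 = 0 := by rw [← hjH]; ring
    have h1 : H ^ 2 + 10 * H + 5 = 0 := pow_eq_zero_iff (by norm_num) |>.mp h3
    exact rat_sq_ne_twenty (H + 5) (by linear_combination h1)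
  · rintro rfl
    have hfac : (H ^ 2 + 4 * H - 1) ^ 2 * (H ^ 2 + 22 * H + 125) = 0 := by
      linear_combination -hjH
    rcases mul_eq_zero.mp hfac with h | h
    · have h1 : H ^ 2 + 4 * H - 1 = 0 := pow_eq_zero_iff (by norm_num) |>.mp h
      exact rat_sq_ne_five (H + 2) (by linear_combination h1)
    · nlinarith [sq_nonneg (H + 11)]

/-- **Level `15` (Kenku's table at `N = 15`; `X₀(15)(ℚ)`, Ligozat / Antwerp IV)**: a cyclic `ℚ`-isogeny of degree `15` out of `V` has
`j(V) ∈ {−5²/2, −5²·241³/2³, −5·29³/2⁵, 5·211³/2¹⁵}`, i.e. `(15, j(V)) ∈ kenkuIsogenyJTable`.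
Proof: Klein–Fricke at `3` and `5` (`exists_j_eq_klein_three/five_of_…_dvd_degree`) give a
non-cuspidal rational point of the fibre product `X₀(3) ×_{X(1)} X₀(5)`, which the tree's explicit
isomorphism `XZeroFifteen.exists_point` sends to a rational point `(x, y)` of `15a1` carrying
`j(V)` as the value of the rational function `(N² + 10NB + 5B²)³/(N B⁵)`; the eight rational points
of `15a1` (landed: `Curve15A1.finite_point`, `stub_fifteenPoints`) are the four cusps (`N B⁵ = 0`, excluded) and four points with exactly the
tabulated values. [cite: Kenku1982, proof of Thm. 1, p. 200] [cite: Ligozat1975]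
[cite: Thorne2019, proof of Lemma 3] -/
theorem levelFifteen_jTable (V V' : WeierstrassCurve ℚ) [V.IsElliptic] [V'.IsElliptic]
    (ψ : Isogeny V V') (hψ : ψ.IsCyclic) (hdeg : ψ.degree = 15) :
    (15, V.j) ∈ kenkuIsogenyJTable := by
  obtain ⟨F, hF0, hjF⟩ :=
    ψ.exists_j_eq_klein_three_of_three_dvd_degree hψ (hdeg ▸ (by norm_num : (3 : ℕ) ∣ 15))
  obtain ⟨H, hH0, hjH⟩ :=
    ψ.exists_j_eq_klein_five_of_five_dvd_degree hψ (hdeg ▸ (by norm_num : (5 : ℕ) ∣ 15))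
  have hjF' : V.j * F = (F + 27) * (F + 3) ^ 3 := by
    rw [hjF]; field_simp
  have hjH' : V.j * H = (H ^ 2 + 10 * H + 5) ^ 3 := by
    rw [hjH]; field_simp
  obtain ⟨hj0, hj1728⟩ := klein_five_j_ne_zero_and_ne_1728 hjH'
  rcases XZeroFifteen.exists_point hH0 hjF' hjH' with h0 | h1728 | ⟨x, y, hxy, hNB, hj⟩
  · exact absurd h0 hj0
  · exact absurd h1728 hj1728
  have hmem := stub_fifteenPoints Curve15A1.finite_point x y hxy
  simp only [Finset.mem_insert, Finset.mem_singleton, Prod.mk.injEq] at hmem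
  rcases hmem with ⟨rfl, rfl⟩ | ⟨rfl, rfl⟩ | ⟨rfl, rfl⟩ | ⟨rfl, rfl⟩ | ⟨rfl, rfl⟩ | ⟨rfl, rfl⟩ |
    ⟨rfl, rfl⟩
  · norm_num at hj
    rw [show V.j = -25 / 2 by linarith [hj]]
    decide +kernel
  · norm_num at hNB
  · norm_num at hj
    rw [show V.j = 46969655 / 32768 by linarith [hj]]
    decide +kernel
  · norm_num at hNB
  · norm_num at hj
    rw [show V.j = -349938025 / 8 by linarith [hj]]
    decide +kernel
  · norm_num at hNB
  · norm_num at hj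
    rw [show V.j = -121945 / 32 by linarith [hj]]
    decide +kernel

/-! ### Level `21`, granted Klein–Fricke at `7` over `ℚ` -/

/-- **Level `21` (Kenku's table at `N = 21`; `X₀(21)(ℚ)`, Ligozat / Antwerp IV), granted Klein–Fricke
at `7` over `ℚ`** (`hK7`; proved in the tree incl. `j = 0`, `computational`: `stub_kleinSevenRat`): a cyclic `ℚ`-isogeny of degree `21` out of `V` has
`j(V) ∈ {−3²5⁶/2³, 3³5³/2, −3²5³101³/2²¹, −3³5³383³/2⁷}`, i.e. `(21, j(V)) ∈ kenkuIsogenyJTable`.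
Proof: Klein–Fricke at `3` (tree) and at `7` (`hK7`, applied to the cyclic degree-`7` quotient) give a non-cuspidal rational point `(F, t)` of `X₀(3) ×_{X(1)} X₀(7)`, which the landed explicit
isomorphism `XZeroTwentyOne.exists_point_rat` (p164263) sends to a rational point `(x, y)` of
`21a1` with `t · B(x, y) = N(x, y)`; of the eight rational points of `21a1` (landed
`stub_twentyonePoints`, p163916, fed by the landed `Curve21A1.finite_point`, p164609) the four cusps give `B = 0 ≠ N` or
`t = 0`, and the other four give `t ∈ {−49/8, −2, −49/2, −8}`, whose Klein–Fricke values are the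
four tabulated `j`. [cite: Kenku1982, proof of Thm. 1, p. 200] [cite: Ligozat1975] -/
theorem levelTwentyOne_jTable_of
    (hK7 : ∀ (W W' : WeierstrassCurve ℚ) [W.IsElliptic] (φ : Isogeny W W'), φ.degree = 7 →
      ∃ t : ℚ, t ≠ 0 ∧ W.j = (t ^ 2 + 13 * t + 49) * (t ^ 2 + 5 * t + 1) ^ 3 / t)
    (V V' : WeierstrassCurve ℚ) [V.IsElliptic] [V'.IsElliptic]
    (ψ : Isogeny V V') (hψ : ψ.IsCyclic) (hdeg : ψ.degree = 21) :
    (21, V.j) ∈ kenkuIsogenyJTable := by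
  obtain ⟨F, hF0, hjF⟩ :=
    ψ.exists_j_eq_klein_three_of_three_dvd_degree hψ (hdeg ▸ (by norm_num : (3 : ℕ) ∣ 21))
  obtain ⟨t, ht0, hjt⟩ : ∃ t : ℚ, t ≠ 0 ∧
      V.j = (t ^ 2 + 13 * t + 49) * (t ^ 2 + 5 * t + 1) ^ 3 / t := by
    obtain ⟨V₇, hV₇, χ, -, hχd, -⟩ :=
      ψ.exists_isCyclic_degree_eq_of_dvd hψ (d := 7) (hdeg ▸ (by norm_num : (7 : ℕ) ∣ 21))
    haveI := hV₇
    exact hK7 V V₇ χ hχd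
  have hjF' : V.j * F = (F + 27) * (F + 3) ^ 3 := by
    rw [hjF]; field_simp
  have hjt' : V.j * t = (t ^ 2 + 13 * t + 49) * (t ^ 2 + 5 * t + 1) ^ 3 := by
    rw [hjt]; field_simp
  obtain ⟨x, y, hxy, hNB⟩ := XZeroTwentyOne.exists_point_rat ht0 hjF' hjt'
  have hmem := stub_twentyonePoints Curve21A1.finite_point x y hxy
  simp only [Finset.mem_insert, Finset.mem_singleton, Prod.mk.injEq] at hmem
  rcases hmem with ⟨rfl, rfl⟩ | ⟨rfl, rfl⟩ | ⟨rfl, rfl⟩ | ⟨rfl, rfl⟩ | ⟨rfl, rfl⟩ | ⟨rfl, rfl⟩ |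
    ⟨rfl, rfl⟩
  · norm_num at hNB
  · norm_num at hNB
    rw [show t = -49 / 8 by linarith [hNB]] at hjt
    norm_num at hjt
    rw [hjt]
    decide +kernel
  · norm_num at hNB
    exact absurd hNB ht0
  · norm_num at hNB
    rw [show t = -2 by linarith [hNB]] at hjt
    norm_num at hjt
    rw [hjt]
    decide +kernel
  · norm_num at hNB
    rw [show t = -49 / 2 by linarith [hNB]] at hjt
    norm_num at hjt
    rw [hjt]
    decide +kernel
  · norm_num at hNB
  · norm_num at hNB
    rw [show t = -8 by linarith [hNB]] at hjt
    norm_num at hjt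
    rw [hjt]
    decide +kernel

/-! ### The ten-table schema from eight tables, and the conditional closers -/

/-- **Kenku's ten `j`-tables from EIGHT**: granted the printed determinations at the eight levels
`N ∈ {11, 17, 19, 27, 37, 43, 67, 163}` (`hT8`) and Klein–Fricke at `7` over `ℚ` (`hK7`, proved in
the tree, `computational`), the ten-table schema of `…OfLiteInputs.lean` holds: levels `15` and
`21` are `levelFifteen_jTable` and `levelTwentyOne_jTable_of`.
[cite: Kenku1982, proof of Thm. 1, p. 200] -/
theorem jTables_of_eight
    (hT8 : ∀ (V V' : WeierstrassCurve ℚ) [V.IsElliptic] [V'.IsElliptic] (ψ : Isogeny V V'),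
      ψ.IsCyclic → ψ.degree ∈ ({11, 17, 19, 27, 37, 43, 67, 163} : Finset ℕ) →
        (ψ.degree, V.j) ∈ kenkuIsogenyJTable)
    (hK7 : ∀ (W W' : WeierstrassCurve ℚ) [W.IsElliptic] (φ : Isogeny W W'), φ.degree = 7 →
      ∃ t : ℚ, t ≠ 0 ∧ W.j = (t ^ 2 + 13 * t + 49) * (t ^ 2 + 5 * t + 1) ^ 3 / t) :
    ∀ (V V' : WeierstrassCurve ℚ) [V.IsElliptic] [V'.IsElliptic] (ψ : Isogeny V V'),
      ψ.IsCyclic → ψ.degree ∈ ({11, 15, 17, 19, 21, 27, 37, 43, 67, 163} : Finset ℕ) →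
        (ψ.degree, V.j) ∈ kenkuIsogenyJTable := by
  intro V V' _ _ ψ hψ hmem
  have hsplit : ∀ n ∈ ({11, 15, 17, 19, 21, 27, 37, 43, 67, 163} : Finset ℕ),
      n = 15 ∨ n = 21 ∨ n ∈ ({11, 17, 19, 27, 37, 43, 67, 163} : Finset ℕ) := by decide
  rcases hsplit _ hmem with h15 | h21 | h8
  · rw [h15]; exact levelFifteen_jTable V V' ψ hψ h15
  · rw [h21]; exact levelTwentyOne_jTable_of hK7 V V' ψ hψ h21
  · exact hT8 V V' ψ hψ h8

/-- **The Mazur–Kenku radius** (sibling crux stmt-ABC-15193, `RibetTakahashiSplit.MazurKenkuRadius`)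
**from Mazur's Cor. 4.4, EIGHT `j`-tables, the six smooth levels and Klein–Fricke at `7`**
(the cycle-23 closer `mazurKenkuRadius_of_cor44_of_jTables_of_liteLevels6` fed with
`jTables_of_eight`). [cite: Mazur1978, Thm. 1 and Cor. 4.4] [cite: Kenku1982, Thm. 1] -/
theorem mazurKenkuRadius_of_eight (h44 : Mazur1978.cor44_valuation_j_le_one)
    (hT8 : ∀ (V V' : WeierstrassCurve ℚ) [V.IsElliptic] [V'.IsElliptic] (ψ : Isogeny V V'),
      ψ.IsCyclic → ψ.degree ∈ ({11, 17, 19, 27, 37, 43, 67, 163} : Finset ℕ) →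
        (ψ.degree, V.j) ∈ kenkuIsogenyJTable)
    (hL6 : ∀ (V V' : WeierstrassCurve ℚ) [V.IsElliptic] [V'.IsElliptic] (ψ : Isogeny V V'),
      ψ.IsCyclic → ψ.degree ∉ ({26, 35, 49, 65, 125, 169} : Finset ℕ))
    (hK7 : ∀ (W W' : WeierstrassCurve ℚ) [W.IsElliptic] (φ : Isogeny W W'), φ.degree = 7 →
      ∃ t : ℚ, t ≠ 0 ∧ W.j = (t ^ 2 + 13 * t + 49) * (t ^ 2 + 5 * t + 1) ^ 3 / t) :
    Summit.ABC.ABC.Theses.RibetTakahashiSplit.MazurKenkuRadius :=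
  mazurKenkuRadius_of_cor44_of_jTables_of_liteLevels6 h44 (jTables_of_eight hT8 hK7) hL6

/-- **The crux `MazurKenkuBound` (stmt-ABC-15125) from Mazur's Cor. 4.4, EIGHT `j`-tables, the
six smooth levels and Klein–Fricke at `7`** (the cycle-23 closer
`mazurKenkuBound_of_cor44_of_jTables_of_liteLevels6` fed with `jTables_of_eight`). The printed
residue of the crux after cycle 24 is exactly `h44`, `hT8`, `hL6`; `hK7` is proved (`computational`).
[cite: PastenShimura2024, §3 p. 13] [cite: Mazur1978, Thm. 1 and Cor. 4.4] [cite: Kenku1982, Thm. 1]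
[cite: EdixhovenManin1991, Prop. 2] -/
theorem mazurKenkuBound_of_eight (h44 : Mazur1978.cor44_valuation_j_le_one)
    (hT8 : ∀ (V V' : WeierstrassCurve ℚ) [V.IsElliptic] [V'.IsElliptic] (ψ : Isogeny V V'),
      ψ.IsCyclic → ψ.degree ∈ ({11, 17, 19, 27, 37, 43, 67, 163} : Finset ℕ) →
        (ψ.degree, V.j) ∈ kenkuIsogenyJTable)
    (hL6 : ∀ (V V' : WeierstrassCurve ℚ) [V.IsElliptic] [V'.IsElliptic] (ψ : Isogeny V V'),
      ψ.IsCyclic → ψ.degree ∉ ({26, 35, 49, 65, 125, 169} : Finset ℕ))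
    (hK7 : ∀ (W W' : WeierstrassCurve ℚ) [W.IsElliptic] (φ : Isogeny W W'), φ.degree = 7 →
      ∃ t : ℚ, t ≠ 0 ∧ W.j = (t ^ 2 + 13 * t + 49) * (t ^ 2 + 5 * t + 1) ^ 3 / t) :
    Summit.ABC.ABC.Theses.IsogenyGlueCongruence.MazurKenkuBound :=
  mazurKenkuBound_of_cor44_of_jTables_of_liteLevels6 h44 (jTables_of_eight hT8 hK7) hL6

end Summit.ABC.ABC.Theorems

end
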